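import Mathlib
import Summits.Ventures.HodgeRepro.LitRank

/-!
# LitRankRestrict — the rank through right translates; Tankeev's inequality (Yanai 1985 Prop. B)

Blind cell `pub-hodge-repro`, seat lit-2 (gen 3).  Companion of `LitRank.lean` (same seat).

* Kubota's rank `dim_ℚ(ℚ[G] τ)` (the span of the LEFT translates `g S̃`) equals the dimension of the
  span of the RIGHT translates `S̃ g` (the Galois conjugates of the type as functions on `G`):
  `rank_eq_finrank_span_rightTranslates`.  Proof: the two spans are the column spaces of the
  matrices `leftMat` / `rightMat`, and `rightMat` is the transpose of `leftMat` re-indexed by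
  `g ↦ g⁻¹` (`rank_transpose`, `rank_submatrix`).
* **Tankeev's inequality**, as printed in Yanai 1985, *On the rank of CM-type*, Nagoya Math. J. 97,
  Prop. B p.171 (store `paper:doi-10-1017-s0027763000021292` p0003:L6–12): "(G, H, S), G₀ and g₀
  being as above, assume S ≠ ⟨g₀⟩.  Then rank(G, H, S) ≥ rank(G₀, {1}, S).  (Note that S can be
  naturally regarded as a CM-type for G₀.)"  Here G₀ = ⟨ρ g₀⟩ is "a complete set of representatives
  of H\G" (p0002:L66–67).  Typed and PROVED for every subgroup `C ∋ ρ` with `H C = G`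
  (`CMTriple.restrict`, `rank_restrict_le`); Yanai's hypothesis `S ≠ ⟨g₀⟩` is only needed for the
  simplicity of the restricted type, not for the inequality.  Proof: the right translates `S̃ c`,
  `c ∈ C`, restrict to the right translates of `S̃ ∩ C` inside `C`, and restriction of functions to
  `C` is injective on left-`H`-invariant functions when `H C = G`.

No new named fact is introduced (D-0026).
-/

open Finset Matrix
open scoped Pointwise

namespace HodgeRepro.Lit2

namespace CMTriple

variable {G : Type*} [Group G] [Fintype G] [DecidableEq G] (T : CMTriple G)

/-! ### The rank through left and right translates as functions `G → ℚ` -/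

/-- The indicator vector of a finset. -/
def indFun (S : Finset G) : G → ℚ := fun x => if x ∈ S then 1 else 0

/-- The matrix whose column `g` is the indicator of the LEFT translate `g S̃`. -/
def leftMat : Matrix G G ℚ := fun x g => if g⁻¹ * x ∈ T.S then 1 else 0

/-- The matrix whose column `g` is the indicator of the RIGHT translate `S̃ g`. -/
def rightMat : Matrix G G ℚ := fun x g => if x * g⁻¹ ∈ T.S then 1 else 0

omit [Fintype G] in
/-- Column `g` of `leftMat` is `𝟙_{g S̃}`. -/
theorem leftMat_col (g : G) : T.leftMat.col g = indFun (g • T.S) := by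
  ext x
  simp only [leftMat, Matrix.col, Matrix.transpose_apply, indFun]
  congr 1
  simp only [Finset.mem_smul_finset, smul_eq_mul, eq_iff_iff]
  constructor
  · intro h; exact ⟨g⁻¹ * x, h, by simp⟩
  · rintro ⟨y, hy, rfl⟩; simpa using hy

omit [Fintype G] in
/-- Column `g` of `rightMat` is `𝟙_{S̃ g}`. -/
theorem rightMat_col (g : G) : T.rightMat.col g = indFun (T.S.image (· * g)) := by
  ext x
  simp only [rightMat, Matrix.col, Matrix.transpose_apply, indFun]
  congr 1
  rw [T.mem_image_mul_right_iff]

omit [Fintype G] in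
/-- `rightMat` is the transpose of `leftMat` re-indexed by `g ↦ g⁻¹` on both sides. -/
theorem rightMat_eq_transpose : T.rightMat = (T.leftMat.submatrix (Equiv.inv G) (Equiv.inv G))ᵀ := by
  ext x g
  simp [rightMat, leftMat, Matrix.transpose_apply, Matrix.submatrix_apply]

/-- `rightMat` and `leftMat` have the same rank (transpose and re-indexing). -/
theorem rank_rightMat : T.rightMat.rank = T.leftMat.rank := by
  rw [rightMat_eq_transpose, Matrix.rank_transpose, Matrix.rank_submatrix]

/-- The coefficient map `ℚ[G] ≃ₗ (G → ℚ)`. -/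
noncomputable def coeffFun : MonoidAlgebra ℚ G ≃ₗ[ℚ] (G → ℚ) :=
  (MonoidAlgebra.coeffLinearEquiv ℚ).trans (Finsupp.linearEquivFunOnFinite ℚ ℚ G)

omit [Group G] [DecidableEq G] in
/-- `coeffFun x g` is the coefficient of `g` in `x`. -/
theorem coeffFun_apply (x : MonoidAlgebra ℚ G) (g : G) : coeffFun x g = x.coeff g := rfl

omit [Group G] in
/-- The coefficient map sends the indicator element of `S` to `indFun S`. -/
theorem coeffFun_sum_single (S : Finset G) :
    coeffFun (∑ s ∈ S, MonoidAlgebra.single s (1 : ℚ)) = indFun S := by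
  ext x
  rw [map_sum, Finset.sum_apply]
  simp only [coeffFun_apply, MonoidAlgebra.coeff_single, Finsupp.single_apply, indFun]
  rw [Finset.sum_ite_eq']

/-- Kubota's rank is the rank of the matrix of left translates. -/
theorem rank_eq_rank_leftMat : T.rank = T.leftMat.rank := by
  rw [T.rank_eq_finrank_span_translates, Matrix.rank_eq_finrank_span_cols]
  have h1 := (LinearEquiv.finrank_map_eq (coeffFun (G := G)) (Submodule.span ℚ
    (Set.range fun g : G => ∑ s ∈ g • T.S, MonoidAlgebra.single s (1 : ℚ)))).symm
  have hs : (⇑((coeffFun (G := G)) : MonoidAlgebra ℚ G →ₗ[ℚ] (G → ℚ)) ''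
      Set.range fun g : G => ∑ s ∈ g • T.S, MonoidAlgebra.single s (1 : ℚ)) =
      Set.range T.leftMat.col := by
    ext v
    simp only [Set.mem_image, Set.mem_range, exists_exists_eq_and, LinearEquiv.coe_coe]
    constructor
    · rintro ⟨g, rfl⟩
      exact ⟨g, by rw [coeffFun_sum_single, leftMat_col]⟩
    · rintro ⟨g, rfl⟩
      exact ⟨g, by rw [coeffFun_sum_single, leftMat_col]⟩
  rw [h1, Submodule.map_span, hs]

/-- **Kubota's rank through RIGHT translates**: `rank = dim span {𝟙_{S̃ g} : g ∈ G}` (the span of the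
Galois conjugates `S̃ g` of the type, as functions on `G`). -/
theorem rank_eq_finrank_span_rightTranslates :
    T.rank = Module.finrank ℚ (Submodule.span ℚ
      (Set.range fun g : G => indFun (T.S.image (· * g)))) := by
  rw [rank_eq_rank_leftMat, ← rank_rightMat, Matrix.rank_eq_finrank_span_cols]
  have hc : T.rightMat.col = fun g : G => indFun (T.S.image (· * g)) := funext T.rightMat_col
  rw [hc]

/-! ### Restriction to a subgroup meeting every coset (Tankeev's inequality, Yanai 1985 Prop. B) -/

section Restrict

variable (C : Subgroup G) [Fintype C]

/-- The restriction of a CM triple to a subgroup `C ∋ ρ`: the triple `(C, 1, S̃ ∩ C)` ("S can be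
naturally regarded as a CM-type for G₀", Yanai p.171). -/
def restrict (hρ : T.ρ ∈ C) : CMTriple C where
  H := ⊥
  ρ := ⟨T.ρ, hρ⟩
  ρ_ne_one := fun h => T.ρ_ne_one (congrArg Subtype.val h)
  ρ_mul_self := Subtype.ext T.ρ_mul_self
  ρ_comm := fun g => Subtype.ext (T.ρ_comm g)
  S := (Finset.univ : Finset C).filter fun c => (c : G) ∈ T.S
  H_mul_mem := fun h hh g hg => by
    rw [Subgroup.mem_bot] at hh
    subst hh
    simpa using hg
  mem_iff := fun c => by
    simp only [Finset.mem_filter, Finset.mem_univ, true_and, Subgroup.coe_mul]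
    exact T.mem_iff c

omit [Fintype G] in
/-- `c ∈ S̃ ∩ C ↔ c ∈ S̃`. -/
theorem mem_restrict_S (hρ : T.ρ ∈ C) (c : C) : c ∈ (T.restrict C hρ).S ↔ (c : G) ∈ T.S := by
  simp [restrict]

/-- Restricting functions on `G` to `C`. -/
noncomputable def resFun : (G → ℚ) →ₗ[ℚ] (C → ℚ) := LinearMap.funLeft ℚ ℚ (Subtype.val : C → G)

omit [Fintype G] [DecidableEq G] [Fintype C] in
/-- `resFun C f c = f c`. -/
theorem resFun_apply (f : G → ℚ) (c : C) : resFun C f c = f c := rfl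

omit [Fintype G] in
/-- The restriction of the indicator of a right translate `S̃ c`, `c ∈ C`, is the indicator of the
right translate `(S̃ ∩ C) c` inside `C`. -/
theorem resFun_indFun_image (hρ : T.ρ ∈ C) (c : C) :
    resFun C (indFun (T.S.image (· * (c : G)))) =
      indFun ((T.restrict C hρ).S.image (· * c)) := by
  ext x
  simp only [resFun_apply, indFun]
  congr 1
  rw [T.mem_image_mul_right_iff, (T.restrict C hρ).mem_image_mul_right_iff, mem_restrict_S]
  rfl

/-- Left-`H`-invariant functions on `G`. -/
def leftInvariant : Submodule ℚ (G → ℚ) where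
  carrier := {f | ∀ h ∈ T.H, ∀ x, f (h * x) = f x}
  zero_mem' := fun _ _ _ => rfl
  add_mem' := fun {f g} hf hg h hh x => by
    simp only [Pi.add_apply, hf h hh x, hg h hh x]
  smul_mem' := fun a {f} hf h hh x => by
    simp only [Pi.smul_apply, hf h hh x]

omit [Fintype G] in
/-- `S̃ g` is `H`-saturated on the left: `h x g⁻¹ ∈ S̃ ↔ x g⁻¹ ∈ S̃`. -/
theorem indFun_image_mem_leftInvariant (g : G) :
    indFun (T.S.image (· * g)) ∈ T.leftInvariant := by
  intro h hh x
  simp only [indFun]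
  congr 1
  rw [T.mem_image_mul_right_iff, T.mem_image_mul_right_iff, mul_assoc, eq_iff_iff]
  constructor
  · intro hx
    have := T.H_mul_mem h⁻¹ (T.H.inv_mem hh) _ hx
    rwa [inv_mul_cancel_left] at this
  · exact T.H_mul_mem h hh _

omit [Fintype G] [DecidableEq G] [Fintype C] in
/-- A left-`H`-invariant function vanishing on a subgroup `C` with `H C = G` vanishes. -/
theorem eq_zero_of_mem_leftInvariant_of_resFun_eq_zero
    (hHC : ∀ x : G, ∃ h ∈ T.H, ∃ c ∈ C, x = h * c) {f : G → ℚ} (hf : f ∈ T.leftInvariant)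
    (h0 : resFun C f = 0) : f = 0 := by
  funext x
  obtain ⟨h, hh, c, hc, rfl⟩ := hHC x
  rw [hf h hh c]
  have := congrFun h0 ⟨c, hc⟩
  simpa [resFun_apply] using this

/-- **Tankeev's inequality** (Yanai 1985 Prop. B, p.171: "rank(G,H,S) ≥ rank(G₀,{1},S)") for every
subgroup `C ∋ ρ` meeting every right coset `H x` (Yanai's `G₀ = ⟨ρ g₀⟩`, "a complete set of
representatives of H\G"): the restricted triple `(C, 1, S̃ ∩ C)` has rank at most `rank(G,H,S̃)`.
Proof: the right translates `S̃ c`, `c ∈ C`, restrict to the right translates of `S̃ ∩ C`, and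
restriction is injective on left-`H`-invariant functions when `H C = G`. -/
theorem rank_restrict_le (hρ : T.ρ ∈ C) (hHC : ∀ x : G, ∃ h ∈ T.H, ∃ c ∈ C, x = h * c) :
    (T.restrict C hρ).rank ≤ T.rank := by
  rw [T.rank_eq_finrank_span_rightTranslates, (T.restrict C hρ).rank_eq_finrank_span_rightTranslates]
  -- the generators indexed by `C`, inside the span of all right translates
  set A : Set (G → ℚ) := Set.range fun c : C => indFun (T.S.image (· * (c : G))) with hA
  have hAle : Submodule.span ℚ A ≤
      Submodule.span ℚ (Set.range fun g : G => indFun (T.S.image (· * g))) := by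
    apply Submodule.span_mono
    rintro _ ⟨c, rfl⟩
    exact ⟨c, rfl⟩
  -- restriction maps `span A` onto the span of the right translates of the restricted triple
  have hmap : (Submodule.span ℚ A).map (resFun C) =
      Submodule.span ℚ (Set.range fun c : C => indFun ((T.restrict C hρ).S.image (· * c))) := by
    rw [Submodule.map_span]
    congr 1
    ext v
    simp only [hA, Set.mem_image, Set.mem_range, exists_exists_eq_and]
    constructor
    · rintro ⟨c, rfl⟩; exact ⟨c, (T.resFun_indFun_image C hρ c).symm⟩
    · rintro ⟨c, rfl⟩; exact ⟨c, T.resFun_indFun_image C hρ c⟩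
  -- restriction is injective on `span A ≤ leftInvariant`
  have hAinv : Submodule.span ℚ A ≤ T.leftInvariant := by
    rw [Submodule.span_le]
    rintro _ ⟨c, rfl⟩
    exact T.indFun_image_mem_leftInvariant _
  have hinj : Function.Injective ((resFun C).domRestrict (Submodule.span ℚ A)) := by
    rw [← LinearMap.ker_eq_bot, LinearMap.ker_domRestrict, Submodule.eq_bot_iff]
    rintro ⟨f, hf⟩ hker
    rw [Submodule.mem_comap, LinearMap.mem_ker, Submodule.subtype_apply] at hker
    exact Subtype.ext (T.eq_zero_of_mem_leftInvariant_of_resFun_eq_zero C hHC (hAinv hf) hker)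
  calc Module.finrank ℚ (Submodule.span ℚ
          (Set.range fun c : C => indFun ((T.restrict C hρ).S.image (· * c))))
      = Module.finrank ℚ ((Submodule.span ℚ A).map (resFun C)) := by rw [hmap]
    _ = Module.finrank ℚ (LinearMap.range ((resFun C).domRestrict (Submodule.span ℚ A))) := by
        rw [LinearMap.range_domRestrict]
    _ = Module.finrank ℚ (Submodule.span ℚ A) := LinearMap.finrank_range_of_inj hinj
    _ ≤ _ := Submodule.finrank_mono hAle

end Restrict

end CMTriple

end HodgeRepro.Lit2
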